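import Summits.QuantumFields.YangMills.Theorems.BalabanUVNodesN11LiveRecordRoughFibre
import Summits.QuantumFields.YangMills.Theorems.BalabanUVNodesN11SmallRegFirstStepFails
import Summits.QuantumFields.YangMills.Theorems.BalabanUVNodesN11FirstStepFailsAtThm1CWitness

/-!
# DAG node N11 — AT EVERY LIVE STAGE-13 WITNESS WITH `εreg` IN [B7] Prop. 2's RANGE THE §2 FORM OF `ρ₁` ITSELF FAILS: `¬ SLaw₁₃ θ p 1`, hence
# `¬ densitiesDescribed (leavesP w p)` at every world bound to its C-binding, hence N11's node conjunct `Dag.B14_main (leavesP w p)` there holds ONLY by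
# refuting the run's interval hypothesis (or an in-edge leaf) — the 𝐑-side reading of seat dag-n11-d's «first step fails»

Cell `pub-ymgap`, YM-PLAN Track A (HUMAN RULING D-0062), seat `pub-ymgap-dag-n11-e` (g7; R134 N11 [B14], strategy s3 «𝐑-operation side»), item K1⁗ `StabilityBAtRecordR13Sep`
= stmt-QuantumFields-20290.  [III] = [Balaban1988Convergent], [IV] = [Balaban1989LargeFieldI], [B7] = [Balaban1985Averaging].  ONE-LINE compositions of this seat's
`…N11LiveRecordRoughFibre` (§2: at the live selector `SLaw₁₃ θ p 1` ⇒ def-T's all-large-field pre-𝐑 slot vanishes a.e. on the rough coarse fields) with seat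
dag-n11-d's SOURCE-AGNOSTIC positivity `…N11SmallRegFirstStepFails.not_slotsT_one_ae_zero_on_rough_of_small_εreg` (that slot does NOT vanish a.e. there when `εreg`
is in [B7] Prop. 2's range: the doubly-rough event is Haar-positive) and `exists_seq_one_Omega_empty`, BY NAME; hypotheses are n11-d's
`not_tLaw₁₃_zero_of_hasResidualsOfRecord_of_small_εreg` VERBATIM plus the selector clause `hsel`.

WHAT THIS FILE PROVES (0 `sorry`, 0 `def`; `N`-generic unless marked `SU(2)`).  §1 at any `θ` at the live selector carrying K0b's residuals, `εreg` in range,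
`0 < K`: ★★★ `not_sLaw₁₃_one_of_liveSel_of_small_εreg` (`¬ SLaw₁₃ θ p 1`), `not_sLaw₁₃_all_of_liveSel_of_small_εreg` (`¬ ∀ k ≤ K, SLaw₁₃ θ p k`), ★★★
`not_densitiesDescribed_leavesP_of_liveSel_of_small_εreg` (N11's node CONCLUSION is FALSE at every world bound to the Stage-13 C-binding of `θ` — the
proviso-free face `…LiveSLaw.densitiesDescribed_leavesP_iff_sLaw₁₃_all`), ★★ `not_smallCouplings_of_b14_main_leavesP_of_liveSel_of_small_εreg` (a world whose
`up`-slots are NODE 00's C-binding over `θ`'s view: `Dag.B14_main (leavesP w p)` together with the in-edge leaves `b7 … b11`, the small-field implication and the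
flow control REFUTES the run's interval hypothesis `smallCouplings` — the `rOperation` antecedent is this seat's `…LiveRstep` theorem); the `SU(2)` forms with the
non-triviality hypothesis discharged as in n11-d's file (`ε₁η₁² + 8δ₀ < 2`).  §2 the same at K0a's ALL-NUMERICS WITNESS FAMILY `theta13LiveOfNumerics n ε₂₉` (K0b's
residuals; `hres`∕`hsel` discharged by name), hypotheses on the member's letters only — it contains node00-def-K0a's `θ₁₅ᶜ = theta13OfThm1C F N ε₀ ε₂₉ B₃ a₀ a₁`
(`rfl`), whose `ν.εreg` IS [15]'s letter `a₀` (`Node00.numerics7OfThm1C_εreg`): ★★★ `not_sLaw₁₃_one_theta13OfThm1C_of_small_εreg` ∕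
`not_densitiesDescribed_leavesP_theta13OfThm1C_of_small_εreg` — at K0⁗'s OWN witness family, for `a₀` in [B7] Prop. 2's range (and the displayed grid ∕
junction ∕ threshold letters), the §2 form of `ρ₁` and N11's node conclusion FAIL on every run with `0 < K`.

READING (count-neutral; K1⁗ = «∃ θ …» is NOT refuted — the witness of record `theta13LiveOfRecord` has `εreg = 1`, OUTSIDE the range, and there only the
necessary conditions of `…LiveRecordRoughFibre` §3–§4 stand): on the live-selector line the located 12a∕def-T junction defect (lit-balaban DESK-ANSWER ME #15;
seat dag-n11-d's kernel certificate) is load-bearing for N11's node conjunct ITSELF, not only for the (S1ᵀ) route to it — 𝐑 of record = id a.e. cannot repair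
the §2 form.  Nothing of Bałaban's asserted or refuted; N11 ∕ K1⁗ NOT discharged; one finite four-torus at fixed `ε = L^{−K}`; NOT ℝ⁴ ∕ OS ∕ mass gap ∕ Clay.
Sources: [III] Theorem p.245, Thm 1 p.262, (2.10)–(2.12) p.256, (2.17)–(2.18) p.257, (3.1)–(3.5) pp.264–265, (3.16) p.268, (3.24)–(3.25) p.270; [IV] (0.3)–(0.4)
p.176; [B7] (10) p.19, Prop. 2 (52)–(54) p.26.
-/

noncomputable section

open MeasureTheory ProbabilityTheory
open scoped BigOperators Matrix.Norms.L2Operator ENNReal NNReal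

namespace Summit.QuantumFields.YangMills.Theorems.BalabanUVNodesN11LiveRecordFirstLevelFails

open Literature.MathematicalPhysics.QuantumFieldTheory.Balaban1983to89 T4Continuum Node00 Node00.Tk DagBinding
open Literature.MathematicalPhysics.QuantumFieldTheory.Balaban1983to89.ExpMeanLog (deltaSU)
open Literature.MathematicalPhysics.QuantumFieldTheory.Balaban1983to89.B16RLeafRecord13AtLive (liveRepin₁₃_liveSel)
open Literature.MathematicalPhysics.QuantumFieldTheory.Balaban1983to89.B16RLeafRecord13LiveRstep (rOperation_leavesP_of_liveSel₁₃_of_hasResiduals)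
open Literature.MathematicalPhysics.QuantumFieldTheory.Balaban1983to89.B16RLeafRecord13LiveSLaw (densitiesDescribed_leavesP_iff_sLaw₁₃_all)
open B14.Eq213MaximalDomains (side)
open Summit.QuantumFields.YangMills.Theorems.BalabanUVNodesN11AllLargeFieldLabel (sideD_pos sideχ_pos)
open Summit.QuantumFields.YangMills.BalabanUVNodes.N07Thm1ScaledInterfaceInstance (su2_dist1_surj)
open Summit.QuantumFields.YangMills.Theorems.BalabanUVNodesN11LiveRecordRoughFibre (slotsT_one_ae_zero_on_rough_of_sLaw₁₃_one_of_liveSel)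
open Summit.QuantumFields.YangMills.Theorems.BalabanUVNodesN11SmallRegFirstStepFails (exists_seq_one_Omega_empty not_slotsT_one_ae_zero_on_rough_of_small_εreg)

variable {F : T4Family} {N : ℕ} [NeZero N]

/-! ## §1. At any live-selector `θ` carrying K0b's residuals with `εreg` in [B7] Prop. 2's range: `¬ SLaw₁₃ θ p 1`, `¬ densitiesDescribed`, `¬ smallCouplings` -/

section LiveSel

variable (θ : Stage13Params F N) (p : B12.RunParams)

/-- **★★★ `¬ SLaw₁₃ θ p 1` AT EVERY LIVE-SELECTOR WITNESS WITH `εreg` IN [B7] PROP. 2's RANGE** (θ carrying K0b's residuals; `0 < K`; `1 ≤ M, M₁, M₂`; grid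
`3·L·M₁ ≤ sideχ`; `0 < ε₁η₁²`; junction at both scales; `SU(N)` non-trivial at the thresholds — n11-d's hypotheses verbatim + the selector clause): the §2 form of
`ρ₁` of record would make def-T's all-large-field pre-𝐑 slot vanish a.e. on the rough coarse fields (`…LiveRecordRoughFibre` §2), which it does not
(n11-d's `not_slotsT_one_ae_zero_on_rough_of_small_εreg`). [cite: Balaban1988Convergent, Thm 1 p.262, (2.18) p.257, (3.25) p.270, (2.10)–(2.12) p.256, (3.2)–(3.5) p.265, (3.16) p.268; Balaban1989LargeFieldI, (0.3)–(0.4) p.176; Balaban1985Averaging, Prop. 2 (52)–(54) p.26] -/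
theorem not_sLaw₁₃_one_of_liveSel_of_small_εreg (hres : θ.HasResidualsOfRecord F N)
    (hsel : θ.ppSel = ppSelLiveOfRecord F N θ.ν θ.τ9 (EOfRecord₁₃ F N θ) (wOfRecord₉ F N θ.toStage9Params)) (hK : 0 < p.K) (hMτ : 1 ≤ θ.τ9.M)
    (hε : 0 < θ.ν.εreg)
    (hε3 : (143 * (((((F.P p.K).d + 4 : ℕ) : ℝ)) ^ 2 / 4) ^ 2) * θ.ν.εreg ≤ 1 / 3)
    (hε2 : 2 * θ.ν.εreg ≤ 2 * deltaSU (Fin N) / ((((F.P p.K).d + 4) * (F.P p.K).L : ℕ) : ℝ) ^ 2)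
    (hM : 1 ≤ θ.ν.M₁) (hM₂ : 1 ≤ θ.ν.M₂) (h3 : 3 * side (F.P p.K).L θ.ν.M₁ 1 ≤ sideχ F θ.ν p (gOfRecord₁₃ F N θ p) 0)
    (hε₁ : 0 < epsOfRecord θ.ν (gOfRecord₁₃ F N θ p) 1 * (F.P p.K).eta 1 ^ 2)
    (hc : θ.s2.cR * epsOfRecord θ.ν (gOfRecord₁₃ F N θ p) 0 ≤ θ.ν.εreg * (F.P p.K).eta 0 ^ 2)
    (hαε : θ.s2.cR * epsOfRecord θ.ν (gOfRecord₁₃ F N θ p) 0 ≤ θ.ν.εreg * (F.P p.K).eta 1 ^ 2)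
    (hg : ∃ g₀ : SU N,
      epsOfRecord θ.ν (gOfRecord₁₃ F N θ p) 1 * (F.P p.K).eta 1 ^ 2 + 4 * (2 * deltaOfRecord θ.ν (gOfRecord₁₃ F N θ p) 0 θ.A₁) < dist1 g₀ ∧
        2 * θ.ν.εreg < dist1 g₀) :
    ¬ SLaw₁₃ F N θ p 1 := by
  intro hS
  obtain ⟨s, hΩ⟩ := exists_seq_one_Omega_empty θ p (sideD_pos (F := F) θ.ν hMτ p (gOfRecord₁₃ F N θ p) 0)
    (sideχ_pos (F := F) hM₂ p (gOfRecord₁₃ F N θ p) 0)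
  exact not_slotsT_one_ae_zero_on_rough_of_small_εreg θ p hres.zetaUnity hK hMτ hε hε3 hε2 hM hM₂ h3 hε₁ hg s hΩ
    (slotsT_one_ae_zero_on_rough_of_sLaw₁₃_one_of_liveSel θ p hres hsel hc hMτ hK s hΩ hS hε hε3 hε2 hαε)

/-- **… so «`ρ_k` has the §2 form for every `k ≤ K`» FAILS there** (`0 < K`; the index `k = 1`). [cite: Balaban1988Convergent, Thm 1 p.262, (2.18) p.257] -/
theorem not_sLaw₁₃_all_of_liveSel_of_small_εreg (hres : θ.HasResidualsOfRecord F N)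
    (hsel : θ.ppSel = ppSelLiveOfRecord F N θ.ν θ.τ9 (EOfRecord₁₃ F N θ) (wOfRecord₉ F N θ.toStage9Params)) (hK : 0 < p.K) (hMτ : 1 ≤ θ.τ9.M)
    (hε : 0 < θ.ν.εreg)
    (hε3 : (143 * (((((F.P p.K).d + 4 : ℕ) : ℝ)) ^ 2 / 4) ^ 2) * θ.ν.εreg ≤ 1 / 3)
    (hε2 : 2 * θ.ν.εreg ≤ 2 * deltaSU (Fin N) / ((((F.P p.K).d + 4) * (F.P p.K).L : ℕ) : ℝ) ^ 2)
    (hM : 1 ≤ θ.ν.M₁) (hM₂ : 1 ≤ θ.ν.M₂) (h3 : 3 * side (F.P p.K).L θ.ν.M₁ 1 ≤ sideχ F θ.ν p (gOfRecord₁₃ F N θ p) 0)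
    (hε₁ : 0 < epsOfRecord θ.ν (gOfRecord₁₃ F N θ p) 1 * (F.P p.K).eta 1 ^ 2)
    (hc : θ.s2.cR * epsOfRecord θ.ν (gOfRecord₁₃ F N θ p) 0 ≤ θ.ν.εreg * (F.P p.K).eta 0 ^ 2)
    (hαε : θ.s2.cR * epsOfRecord θ.ν (gOfRecord₁₃ F N θ p) 0 ≤ θ.ν.εreg * (F.P p.K).eta 1 ^ 2)
    (hg : ∃ g₀ : SU N,
      epsOfRecord θ.ν (gOfRecord₁₃ F N θ p) 1 * (F.P p.K).eta 1 ^ 2 + 4 * (2 * deltaOfRecord θ.ν (gOfRecord₁₃ F N θ p) 0 θ.A₁) < dist1 g₀ ∧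
        2 * θ.ν.εreg < dist1 g₀) :
    ¬ (∀ k, k ≤ p.K → SLaw₁₃ F N θ p k) := fun h =>
  not_sLaw₁₃_one_of_liveSel_of_small_εreg θ p hres hsel hK hMτ hε hε3 hε2 hM hM₂ h3 hε₁ hc hαε hg (h 1 hK)

variable (w : WorldP)

/-- **★★★ N11's NODE CONCLUSION IS FALSE AT EVERY WORLD BOUND TO THE STAGE-13 C-BINDING OF SUCH A WITNESS**: `¬ densitiesDescribed (leavesP w p)` whenever
`w.C = (coreOfRecord₁₃ θ).construction (densOfRecord₁₃ θ)` (what every `datumOfRecord₁₃… θ h` carries as `C`, proviso-free), on every run with `0 < K`.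
[cite: Balaban1988Convergent, Thm 1 p.262, (2.18) p.257, (3.25) p.270, (2.12) p.256, (3.16) p.268; Balaban1989LargeFieldI, (0.3)–(0.4) p.176; Balaban1985Averaging, Prop. 2 (52)–(54) p.26] -/
theorem not_densitiesDescribed_leavesP_of_liveSel_of_small_εreg (hC : w.C = (coreOfRecord₁₃ F N θ).construction (densOfRecord₁₃ F N θ))
    (hres : θ.HasResidualsOfRecord F N)
    (hsel : θ.ppSel = ppSelLiveOfRecord F N θ.ν θ.τ9 (EOfRecord₁₃ F N θ) (wOfRecord₉ F N θ.toStage9Params)) (hK : 0 < p.K) (hMτ : 1 ≤ θ.τ9.M)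
    (hε : 0 < θ.ν.εreg)
    (hε3 : (143 * (((((F.P p.K).d + 4 : ℕ) : ℝ)) ^ 2 / 4) ^ 2) * θ.ν.εreg ≤ 1 / 3)
    (hε2 : 2 * θ.ν.εreg ≤ 2 * deltaSU (Fin N) / ((((F.P p.K).d + 4) * (F.P p.K).L : ℕ) : ℝ) ^ 2)
    (hM : 1 ≤ θ.ν.M₁) (hM₂ : 1 ≤ θ.ν.M₂) (h3 : 3 * side (F.P p.K).L θ.ν.M₁ 1 ≤ sideχ F θ.ν p (gOfRecord₁₃ F N θ p) 0)
    (hε₁ : 0 < epsOfRecord θ.ν (gOfRecord₁₃ F N θ p) 1 * (F.P p.K).eta 1 ^ 2)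
    (hc : θ.s2.cR * epsOfRecord θ.ν (gOfRecord₁₃ F N θ p) 0 ≤ θ.ν.εreg * (F.P p.K).eta 0 ^ 2)
    (hαε : θ.s2.cR * epsOfRecord θ.ν (gOfRecord₁₃ F N θ p) 0 ≤ θ.ν.εreg * (F.P p.K).eta 1 ^ 2)
    (hg : ∃ g₀ : SU N,
      epsOfRecord θ.ν (gOfRecord₁₃ F N θ p) 1 * (F.P p.K).eta 1 ^ 2 + 4 * (2 * deltaOfRecord θ.ν (gOfRecord₁₃ F N θ p) 0 θ.A₁) < dist1 g₀ ∧
        2 * θ.ν.εreg < dist1 g₀) :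
    ¬ (leavesP w p).densitiesDescribed := fun hD =>
  not_sLaw₁₃_all_of_liveSel_of_small_εreg θ p hres hsel hK hMτ hε hε3 hε2 hM hM₂ h3 hε₁ hc hαε hg
    ((densitiesDescribed_leavesP_iff_sLaw₁₃_all F N θ p w hC).1 hD)

/-- **★★ HENCE N11's NODE CONJUNCT THERE REFUTES THE RUN'S INTERVAL HYPOTHESIS**: at a world whose C-binding is `θ`'s construction and whose `up`-slots are
NODE 00's C-binding over `θ`'s Stage-13 view (`θ` admissible, the three term-constant signs — for the 𝐑-antecedent, this seat's `…LiveRstep` theorem),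
`Dag.B14_main (leavesP w p)` together with the in-edge leaves `b7 … b11`, the small-field implication and the flow control gives `¬ smallCouplings` on every run
with `0 < K`.  So K1⁗'s rung-1 conjunct «all nodes at all runs» at such a witness can only coexist with its rung-2 window (runs with `K ≥ 1` IN the interval)
through a false in-edge leaf. [cite: Balaban1988Convergent, Thm 1 p.262, Theorem p.245, p.244, (3.25) p.270, (2.12) p.256; Balaban1989LargeFieldI, (0.3)–(0.4) p.176; Balaban1985Averaging, Prop. 2 (52)–(54) p.26] -/
theorem not_smallCouplings_of_b14_main_leavesP_of_liveSel_of_small_εreg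
    (hC : w.C = (coreOfRecord₁₃ F N θ).construction (densOfRecord₁₃ F N θ)) (hup : w.up p = upOfRecord₅C F N (θ.toStage5₁₃ F N) p)
    (hres : θ.HasResidualsOfRecord F N) (hθ : θ.Admissible F N) (hκ : 0 ≤ θ.s2.lf.κ) (hE₀ : 0 ≤ θ.s2.lf.E₀) (hB₀ : 0 ≤ θ.s2.lf.B₀)
    (hsel : θ.ppSel = ppSelLiveOfRecord F N θ.ν θ.τ9 (EOfRecord₁₃ F N θ) (wOfRecord₉ F N θ.toStage9Params)) (hK : 0 < p.K) (hMτ : 1 ≤ θ.τ9.M)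
    (hε : 0 < θ.ν.εreg)
    (hε3 : (143 * (((((F.P p.K).d + 4 : ℕ) : ℝ)) ^ 2 / 4) ^ 2) * θ.ν.εreg ≤ 1 / 3)
    (hε2 : 2 * θ.ν.εreg ≤ 2 * deltaSU (Fin N) / ((((F.P p.K).d + 4) * (F.P p.K).L : ℕ) : ℝ) ^ 2)
    (hM : 1 ≤ θ.ν.M₁) (hM₂ : 1 ≤ θ.ν.M₂) (h3 : 3 * side (F.P p.K).L θ.ν.M₁ 1 ≤ sideχ F θ.ν p (gOfRecord₁₃ F N θ p) 0)
    (hε₁ : 0 < epsOfRecord θ.ν (gOfRecord₁₃ F N θ p) 1 * (F.P p.K).eta 1 ^ 2)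
    (hc : θ.s2.cR * epsOfRecord θ.ν (gOfRecord₁₃ F N θ p) 0 ≤ θ.ν.εreg * (F.P p.K).eta 0 ^ 2)
    (hαε : θ.s2.cR * epsOfRecord θ.ν (gOfRecord₁₃ F N θ p) 0 ≤ θ.ν.εreg * (F.P p.K).eta 1 ^ 2)
    (hg : ∃ g₀ : SU N,
      epsOfRecord θ.ν (gOfRecord₁₃ F N θ p) 1 * (F.P p.K).eta 1 ^ 2 + 4 * (2 * deltaOfRecord θ.ν (gOfRecord₁₃ F N θ p) 0 θ.A₁) < dist1 g₀ ∧
        2 * θ.ν.εreg < dist1 g₀)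
    (h14 : Dag.B14_main (leavesP w p))
    (h7 : (leavesP w p).b7) (h8 : (leavesP w p).b8) (h9 : (leavesP w p).b9) (h10 : (leavesP w p).b10) (h11 : (leavesP w p).b11)
    (hsf : (leavesP w p).smallCouplings → (leavesP w p).smallFieldInductive) (hfc : (leavesP w p).smallCouplings → (leavesP w p).flowControl) :
    ¬ (leavesP w p).smallCouplings := fun hsc =>
  not_densitiesDescribed_leavesP_of_liveSel_of_small_εreg θ p w hC hres hsel hK hMτ hε hε3 hε2 hM hM₂ h3 hε₁ hc hαε hg
    (h14 h7 h8 h9 h10 h11 hsf hfc (rOperation_leavesP_of_liveSel₁₃_of_hasResiduals F N θ p w hup hres hθ hκ hE₀ hB₀ hsel) hsc)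

end LiveSel

/-! ## §1b. At the group of record `SU(2)`: the non-triviality hypothesis discharged (`ε₁η₁² + 8δ₀ < 2`; n11-d's `su2` form) -/

section SU2

variable {F : T4Family} (θ : Stage13Params F 2) (p : B12.RunParams)

/-- **`¬ SLaw₁₃ F 2 θ p 1` at the group of record** — the `SU(2)` element at distance `2` (n07-e's `su2_dist1_surj`) discharges `hg` as in n11-d's
`not_tLaw₁₃_zero_su2_of_hasResidualsOfRecord_of_small_εreg`. [cite: Balaban1988Convergent, Thm 1 p.262, (2.18) p.257, (3.25) p.270, (2.12) p.256; Balaban1985Averaging, Prop. 2 (52)–(54) p.26] -/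
theorem not_sLaw₁₃_one_su2_of_liveSel_of_small_εreg (hres : θ.HasResidualsOfRecord F 2)
    (hsel : θ.ppSel = ppSelLiveOfRecord F 2 θ.ν θ.τ9 (EOfRecord₁₃ F 2 θ) (wOfRecord₉ F 2 θ.toStage9Params)) (hK : 0 < p.K) (hMτ : 1 ≤ θ.τ9.M)
    (hε : 0 < θ.ν.εreg)
    (hε3 : (143 * (((((F.P p.K).d + 4 : ℕ) : ℝ)) ^ 2 / 4) ^ 2) * θ.ν.εreg ≤ 1 / 3)
    (hε2 : 2 * θ.ν.εreg ≤ 2 * deltaSU (Fin 2) / ((((F.P p.K).d + 4) * (F.P p.K).L : ℕ) : ℝ) ^ 2)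
    (hM : 1 ≤ θ.ν.M₁) (hM₂ : 1 ≤ θ.ν.M₂) (h3 : 3 * side (F.P p.K).L θ.ν.M₁ 1 ≤ sideχ F θ.ν p (gOfRecord₁₃ F 2 θ p) 0)
    (hε₁ : 0 < epsOfRecord θ.ν (gOfRecord₁₃ F 2 θ p) 1 * (F.P p.K).eta 1 ^ 2)
    (hc : θ.s2.cR * epsOfRecord θ.ν (gOfRecord₁₃ F 2 θ p) 0 ≤ θ.ν.εreg * (F.P p.K).eta 0 ^ 2)
    (hαε : θ.s2.cR * epsOfRecord θ.ν (gOfRecord₁₃ F 2 θ p) 0 ≤ θ.ν.εreg * (F.P p.K).eta 1 ^ 2)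
    (hδ : epsOfRecord θ.ν (gOfRecord₁₃ F 2 θ p) 1 * (F.P p.K).eta 1 ^ 2 + 4 * (2 * deltaOfRecord θ.ν (gOfRecord₁₃ F 2 θ p) 0 θ.A₁) < 2) :
    ¬ SLaw₁₃ F 2 θ p 1 := by
  obtain ⟨g₀, hg₀⟩ := su2_dist1_surj 2 zero_le_two le_rfl
  have hd : (F.P p.K).d = 4 := rfl
  have hεlt : 2 * θ.ν.εreg < 2 := by
    rw [hd] at hε3
    norm_num at hε3
    linarith
  exact not_sLaw₁₃_one_of_liveSel_of_small_εreg θ p hres hsel hK hMτ hε hε3 hε2 hM hM₂ h3 hε₁ hc hαε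
    ⟨g₀, by rw [hg₀]; exact hδ, by rw [hg₀]; exact hεlt⟩

/-- **`¬ densitiesDescribed (leavesP w p)` at the group of record**, every world bound to `θ`'s Stage-13 C-binding, `0 < K`.
[cite: Balaban1988Convergent, Thm 1 p.262, (2.18) p.257, (3.25) p.270, (2.12) p.256; Balaban1985Averaging, Prop. 2 (52)–(54) p.26] -/
theorem not_densitiesDescribed_leavesP_su2_of_liveSel_of_small_εreg (w : WorldP)
    (hC : w.C = (coreOfRecord₁₃ F 2 θ).construction (densOfRecord₁₃ F 2 θ)) (hres : θ.HasResidualsOfRecord F 2)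
    (hsel : θ.ppSel = ppSelLiveOfRecord F 2 θ.ν θ.τ9 (EOfRecord₁₃ F 2 θ) (wOfRecord₉ F 2 θ.toStage9Params)) (hK : 0 < p.K) (hMτ : 1 ≤ θ.τ9.M)
    (hε : 0 < θ.ν.εreg)
    (hε3 : (143 * (((((F.P p.K).d + 4 : ℕ) : ℝ)) ^ 2 / 4) ^ 2) * θ.ν.εreg ≤ 1 / 3)
    (hε2 : 2 * θ.ν.εreg ≤ 2 * deltaSU (Fin 2) / ((((F.P p.K).d + 4) * (F.P p.K).L : ℕ) : ℝ) ^ 2)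
    (hM : 1 ≤ θ.ν.M₁) (hM₂ : 1 ≤ θ.ν.M₂) (h3 : 3 * side (F.P p.K).L θ.ν.M₁ 1 ≤ sideχ F θ.ν p (gOfRecord₁₃ F 2 θ p) 0)
    (hε₁ : 0 < epsOfRecord θ.ν (gOfRecord₁₃ F 2 θ p) 1 * (F.P p.K).eta 1 ^ 2)
    (hc : θ.s2.cR * epsOfRecord θ.ν (gOfRecord₁₃ F 2 θ p) 0 ≤ θ.ν.εreg * (F.P p.K).eta 0 ^ 2)
    (hαε : θ.s2.cR * epsOfRecord θ.ν (gOfRecord₁₃ F 2 θ p) 0 ≤ θ.ν.εreg * (F.P p.K).eta 1 ^ 2)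
    (hδ : epsOfRecord θ.ν (gOfRecord₁₃ F 2 θ p) 1 * (F.P p.K).eta 1 ^ 2 + 4 * (2 * deltaOfRecord θ.ν (gOfRecord₁₃ F 2 θ p) 0 θ.A₁) < 2) :
    ¬ (leavesP w p).densitiesDescribed := fun hD =>
  not_sLaw₁₃_one_su2_of_liveSel_of_small_εreg θ p hres hsel hK hMτ hε hε3 hε2 hM hM₂ h3 hε₁ hc hαε hδ
    ((densitiesDescribed_leavesP_iff_sLaw₁₃_all F 2 θ p w hC).1 hD 1 hK)

end SU2

/-! ## §2. At K0a's all-numerics witness family `theta13LiveOfNumerics n ε₂₉` and at node00-def-K0a's `θ₁₅ᶜ` (`εreg = a₀`) -/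

section Numerics

variable (F N)
variable (n : Stage12Numerics) (ε₂₉ : ℝ) (p : B12.RunParams)

/-- **★★★ `¬ SLaw₁₃ … p 1` AT K0a's ALL-NUMERICS LIVE WITNESS `θ₁₃(n, ε₂₉)`** (K0b's residuals and the live selector by construction — `hres`, `hsel` discharged by
name) whenever the member's regularity letter `εreg` is in [B7] Prop. 2's range, with the displayed grid ∕ junction ∕ threshold letters and `0 < K`.
[cite: Balaban1988Convergent, Thm 1 p.262, (2.18) p.257, (3.25) p.270, (2.12) p.256, (3.16) p.268; Balaban1989LargeFieldI, (0.3)–(0.4) p.176; Balaban1985Averaging, Prop. 2 (52)–(54) p.26] -/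
theorem not_sLaw₁₃_one_theta13LiveOfNumerics_of_small_εreg (hK : 0 < p.K)
    (hMτ : 1 ≤ (theta13LiveOfNumerics F N n ε₂₉ (zeta316OfRecord F N n.ν n.τ9.M n.A₁) (RzOfRecord F N) (ZtOfRecord F N)).τ9.M)
    (hε : 0 < (theta13LiveOfNumerics F N n ε₂₉ (zeta316OfRecord F N n.ν n.τ9.M n.A₁) (RzOfRecord F N) (ZtOfRecord F N)).ν.εreg)
    (hε3 : (143 * (((((F.P p.K).d + 4 : ℕ) : ℝ)) ^ 2 / 4) ^ 2) *
      (theta13LiveOfNumerics F N n ε₂₉ (zeta316OfRecord F N n.ν n.τ9.M n.A₁) (RzOfRecord F N) (ZtOfRecord F N)).ν.εreg ≤ 1 / 3)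
    (hε2 : 2 * (theta13LiveOfNumerics F N n ε₂₉ (zeta316OfRecord F N n.ν n.τ9.M n.A₁) (RzOfRecord F N) (ZtOfRecord F N)).ν.εreg ≤
      2 * deltaSU (Fin N) / ((((F.P p.K).d + 4) * (F.P p.K).L : ℕ) : ℝ) ^ 2)
    (hM : 1 ≤ (theta13LiveOfNumerics F N n ε₂₉ (zeta316OfRecord F N n.ν n.τ9.M n.A₁) (RzOfRecord F N) (ZtOfRecord F N)).ν.M₁)
    (hM₂ : 1 ≤ (theta13LiveOfNumerics F N n ε₂₉ (zeta316OfRecord F N n.ν n.τ9.M n.A₁) (RzOfRecord F N) (ZtOfRecord F N)).ν.M₂)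
    (h3 : 3 * side (F.P p.K).L (theta13LiveOfNumerics F N n ε₂₉ (zeta316OfRecord F N n.ν n.τ9.M n.A₁) (RzOfRecord F N) (ZtOfRecord F N)).ν.M₁ 1 ≤
      sideχ F (theta13LiveOfNumerics F N n ε₂₉ (zeta316OfRecord F N n.ν n.τ9.M n.A₁) (RzOfRecord F N) (ZtOfRecord F N)).ν p
        (gOfRecord₁₃ F N (theta13LiveOfNumerics F N n ε₂₉ (zeta316OfRecord F N n.ν n.τ9.M n.A₁) (RzOfRecord F N) (ZtOfRecord F N)) p) 0)
    (hε₁ : 0 < epsOfRecord (theta13LiveOfNumerics F N n ε₂₉ (zeta316OfRecord F N n.ν n.τ9.M n.A₁) (RzOfRecord F N) (ZtOfRecord F N)).ν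
      (gOfRecord₁₃ F N (theta13LiveOfNumerics F N n ε₂₉ (zeta316OfRecord F N n.ν n.τ9.M n.A₁) (RzOfRecord F N) (ZtOfRecord F N)) p) 1 * (F.P p.K).eta 1 ^ 2)
    (hc : (theta13LiveOfNumerics F N n ε₂₉ (zeta316OfRecord F N n.ν n.τ9.M n.A₁) (RzOfRecord F N) (ZtOfRecord F N)).s2.cR *
        epsOfRecord (theta13LiveOfNumerics F N n ε₂₉ (zeta316OfRecord F N n.ν n.τ9.M n.A₁) (RzOfRecord F N) (ZtOfRecord F N)).ν
          (gOfRecord₁₃ F N (theta13LiveOfNumerics F N n ε₂₉ (zeta316OfRecord F N n.ν n.τ9.M n.A₁) (RzOfRecord F N) (ZtOfRecord F N)) p) 0 ≤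
      (theta13LiveOfNumerics F N n ε₂₉ (zeta316OfRecord F N n.ν n.τ9.M n.A₁) (RzOfRecord F N) (ZtOfRecord F N)).ν.εreg * (F.P p.K).eta 0 ^ 2)
    (hαε : (theta13LiveOfNumerics F N n ε₂₉ (zeta316OfRecord F N n.ν n.τ9.M n.A₁) (RzOfRecord F N) (ZtOfRecord F N)).s2.cR *
        epsOfRecord (theta13LiveOfNumerics F N n ε₂₉ (zeta316OfRecord F N n.ν n.τ9.M n.A₁) (RzOfRecord F N) (ZtOfRecord F N)).ν
          (gOfRecord₁₃ F N (theta13LiveOfNumerics F N n ε₂₉ (zeta316OfRecord F N n.ν n.τ9.M n.A₁) (RzOfRecord F N) (ZtOfRecord F N)) p) 0 ≤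
      (theta13LiveOfNumerics F N n ε₂₉ (zeta316OfRecord F N n.ν n.τ9.M n.A₁) (RzOfRecord F N) (ZtOfRecord F N)).ν.εreg * (F.P p.K).eta 1 ^ 2)
    (hg : ∃ g₀ : SU N,
      epsOfRecord (theta13LiveOfNumerics F N n ε₂₉ (zeta316OfRecord F N n.ν n.τ9.M n.A₁) (RzOfRecord F N) (ZtOfRecord F N)).ν
            (gOfRecord₁₃ F N (theta13LiveOfNumerics F N n ε₂₉ (zeta316OfRecord F N n.ν n.τ9.M n.A₁) (RzOfRecord F N) (ZtOfRecord F N)) p) 1 *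
              (F.P p.K).eta 1 ^ 2 +
          4 * (2 * deltaOfRecord (theta13LiveOfNumerics F N n ε₂₉ (zeta316OfRecord F N n.ν n.τ9.M n.A₁) (RzOfRecord F N) (ZtOfRecord F N)).ν
            (gOfRecord₁₃ F N (theta13LiveOfNumerics F N n ε₂₉ (zeta316OfRecord F N n.ν n.τ9.M n.A₁) (RzOfRecord F N) (ZtOfRecord F N)) p) 0
            (theta13LiveOfNumerics F N n ε₂₉ (zeta316OfRecord F N n.ν n.τ9.M n.A₁) (RzOfRecord F N) (ZtOfRecord F N)).A₁) < dist1 g₀ ∧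
        2 * (theta13LiveOfNumerics F N n ε₂₉ (zeta316OfRecord F N n.ν n.τ9.M n.A₁) (RzOfRecord F N) (ZtOfRecord F N)).ν.εreg < dist1 g₀) :
    ¬ SLaw₁₃ F N (theta13LiveOfNumerics F N n ε₂₉ (zeta316OfRecord F N n.ν n.τ9.M n.A₁) (RzOfRecord F N) (ZtOfRecord F N)) p 1 :=
  not_sLaw₁₃_one_of_liveSel_of_small_εreg _ p (hasResidualsOfRecord_theta13LiveOfNumerics F N n ε₂₉)
    (liveRepin₁₃_liveSel F N (theta13OfNumerics F N n ε₂₉ _ _ _)) hK hMτ hε hε3 hε2 hM hM₂ h3 hε₁ hc hαε hg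

end Numerics

section Thm1CWitness

variable {F : T4Family} (ε₀ ε₂₉ B₃ a₀ a₁ : ℝ) (p : B12.RunParams)

/-- `θ₁₅ᶜ`'s regularity letter IS [15]'s `a₀` (`rfl` through `Node00.numerics7OfThm1C_εreg`). [cite: Balaban1988Convergent, (2.12) p.256; Balaban1985Variational, Thm 1 p.279 (bookkeeping witness)] -/
theorem theta13OfThm1C_εreg (N : ℕ) [NeZero N] : (theta13OfThm1C F N ε₀ ε₂₉ B₃ a₀ a₁).ν.εreg = a₀ := rfl

/-- `θ₁₅ᶜ`'s located regularity constant is `cR = 1` (`rfl`). [cite: Balaban1988Convergent, (2.10) p.256 (bookkeeping witness)] -/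
theorem theta13OfThm1C_cR (N : ℕ) [NeZero N] : (theta13OfThm1C F N ε₀ ε₂₉ B₃ a₀ a₁).s2.cR = 1 := rfl

/-- `θ₁₅ᶜ`'s cube letters are `M₁ = M₂ = 1` and `M = 1` (`rfl`). [cite: Balaban1988Convergent, (2.4)–(2.5) p.255; Balaban1989LargeFieldI, (2.1) p.182 (bookkeeping witness)] -/
theorem theta13OfThm1C_M₁_M₂_M (N : ℕ) [NeZero N] :
    (theta13OfThm1C F N ε₀ ε₂₉ B₃ a₀ a₁).ν.M₁ = 1 ∧ (theta13OfThm1C F N ε₀ ε₂₉ B₃ a₀ a₁).ν.M₂ = 1 ∧ (theta13OfThm1C F N ε₀ ε₂₉ B₃ a₀ a₁).τ9.M = 1 :=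
  ⟨rfl, rfl, rfl⟩

/-- **★★★ AT node00-def-K0a's `L`-KEYED [15]-KEYED WITNESS `θ₁₅ᶜ = theta13OfThm1C F 2 ε₀ ε₂₉ B₃ a₀ a₁` (K0⁗'s OWN witness family, group of record `SU(2)`): for
`a₀` IN [B7] Prop. 2's RANGE the §2 form of `ρ₁` FAILS** — `¬ SLaw₁₃ F 2 θ₁₅ᶜ p 1` on every run with `0 < K`, under the displayed grid condition
`3·L ≤ sideχ`, `0 < ε₁η₁²`, the junction `ε₀(g₀) ≤ a₀·η₀²` ∧ `≤ a₀·η₁²` (def-P11's numerics clause along the run) and the threshold letter `ε₁η₁² + 8δ₀ < 2`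
(`εreg = a₀`, `cR = M = M₁ = M₂ = 1` by `rfl`). [cite: Balaban1988Convergent, Thm 1 p.262, (2.18) p.257, (3.25) p.270, (2.10)–(2.12) p.256, (3.16) p.268; Balaban1989LargeFieldI, (0.3)–(0.4) p.176; Balaban1985Averaging, Prop. 2 (52)–(54) p.26; Balaban1985Variational, Thm 1 p.279 (witness letters only)] -/
theorem not_sLaw₁₃_one_su2_theta13OfThm1C_of_small_εreg (hK : 0 < p.K) (ha₀ : 0 < a₀)
    (ha3 : (143 * (((((F.P p.K).d + 4 : ℕ) : ℝ)) ^ 2 / 4) ^ 2) * a₀ ≤ 1 / 3)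
    (ha2 : 2 * a₀ ≤ 2 * deltaSU (Fin 2) / ((((F.P p.K).d + 4) * (F.P p.K).L : ℕ) : ℝ) ^ 2)
    (h3 : 3 * side (F.P p.K).L 1 1 ≤ sideχ F (theta13OfThm1C F 2 ε₀ ε₂₉ B₃ a₀ a₁).ν p (gOfRecord₁₃ F 2 (theta13OfThm1C F 2 ε₀ ε₂₉ B₃ a₀ a₁) p) 0)
    (hε₁ : 0 < epsOfRecord (theta13OfThm1C F 2 ε₀ ε₂₉ B₃ a₀ a₁).ν (gOfRecord₁₃ F 2 (theta13OfThm1C F 2 ε₀ ε₂₉ B₃ a₀ a₁) p) 1 * (F.P p.K).eta 1 ^ 2)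
    (hc : epsOfRecord (theta13OfThm1C F 2 ε₀ ε₂₉ B₃ a₀ a₁).ν (gOfRecord₁₃ F 2 (theta13OfThm1C F 2 ε₀ ε₂₉ B₃ a₀ a₁) p) 0 ≤ a₀ * (F.P p.K).eta 0 ^ 2)
    (hαε : epsOfRecord (theta13OfThm1C F 2 ε₀ ε₂₉ B₃ a₀ a₁).ν (gOfRecord₁₃ F 2 (theta13OfThm1C F 2 ε₀ ε₂₉ B₃ a₀ a₁) p) 0 ≤ a₀ * (F.P p.K).eta 1 ^ 2)
    (hδ : epsOfRecord (theta13OfThm1C F 2 ε₀ ε₂₉ B₃ a₀ a₁).ν (gOfRecord₁₃ F 2 (theta13OfThm1C F 2 ε₀ ε₂₉ B₃ a₀ a₁) p) 1 * (F.P p.K).eta 1 ^ 2 +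
      4 * (2 * deltaOfRecord (theta13OfThm1C F 2 ε₀ ε₂₉ B₃ a₀ a₁).ν (gOfRecord₁₃ F 2 (theta13OfThm1C F 2 ε₀ ε₂₉ B₃ a₀ a₁) p) 0
        (theta13OfThm1C F 2 ε₀ ε₂₉ B₃ a₀ a₁).A₁) < 2) :
    ¬ SLaw₁₃ F 2 (theta13OfThm1C F 2 ε₀ ε₂₉ B₃ a₀ a₁) p 1 :=
  not_sLaw₁₃_one_su2_of_liveSel_of_small_εreg (theta13OfThm1C F 2 ε₀ ε₂₉ B₃ a₀ a₁) p (hasResidualsOfRecord_theta13OfThm1C F 2 ε₀ ε₂₉ B₃ a₀ a₁)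
    (liveRepin₁₃_liveSel F 2 (theta13OfNumerics F 2 (stage12NumericsOfThm1C F.L ε₀ B₃ a₀ a₁) ε₂₉ _ _ _)) hK le_rfl ha₀ ha3 ha2 le_rfl le_rfl h3 hε₁
    (by rw [theta13OfThm1C_cR, one_mul]; exact hc) (by rw [theta13OfThm1C_cR, one_mul]; exact hαε) hδ

/-- **★★★ … HENCE N11's NODE CONCLUSION FAILS AT EVERY WORLD BOUND TO `θ₁₅ᶜ`'s C-BINDING** (in particular at every world of K1⁗'s rung-1 binder shape over this
witness, whatever datum re-key `datumOfRecord₁₃… θ₁₅ᶜ h` supplies `C`), on every run with `0 < K`, for `a₀` in [B7] Prop. 2's range and the displayed letters.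
[cite: Balaban1988Convergent, Thm 1 p.262, (2.18) p.257, (3.25) p.270, (2.12) p.256; Balaban1985Averaging, Prop. 2 (52)–(54) p.26; Balaban1985Variational, Thm 1 p.279 (witness letters only)] -/
theorem not_densitiesDescribed_leavesP_theta13OfThm1C_of_small_εreg (w : WorldP)
    (hC : w.C = (coreOfRecord₁₃ F 2 (theta13OfThm1C F 2 ε₀ ε₂₉ B₃ a₀ a₁)).construction (densOfRecord₁₃ F 2 (theta13OfThm1C F 2 ε₀ ε₂₉ B₃ a₀ a₁)))
    (hK : 0 < p.K) (ha₀ : 0 < a₀)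
    (ha3 : (143 * (((((F.P p.K).d + 4 : ℕ) : ℝ)) ^ 2 / 4) ^ 2) * a₀ ≤ 1 / 3)
    (ha2 : 2 * a₀ ≤ 2 * deltaSU (Fin 2) / ((((F.P p.K).d + 4) * (F.P p.K).L : ℕ) : ℝ) ^ 2)
    (h3 : 3 * side (F.P p.K).L 1 1 ≤ sideχ F (theta13OfThm1C F 2 ε₀ ε₂₉ B₃ a₀ a₁).ν p (gOfRecord₁₃ F 2 (theta13OfThm1C F 2 ε₀ ε₂₉ B₃ a₀ a₁) p) 0)
    (hε₁ : 0 < epsOfRecord (theta13OfThm1C F 2 ε₀ ε₂₉ B₃ a₀ a₁).ν (gOfRecord₁₃ F 2 (theta13OfThm1C F 2 ε₀ ε₂₉ B₃ a₀ a₁) p) 1 * (F.P p.K).eta 1 ^ 2)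
    (hc : epsOfRecord (theta13OfThm1C F 2 ε₀ ε₂₉ B₃ a₀ a₁).ν (gOfRecord₁₃ F 2 (theta13OfThm1C F 2 ε₀ ε₂₉ B₃ a₀ a₁) p) 0 ≤ a₀ * (F.P p.K).eta 0 ^ 2)
    (hαε : epsOfRecord (theta13OfThm1C F 2 ε₀ ε₂₉ B₃ a₀ a₁).ν (gOfRecord₁₃ F 2 (theta13OfThm1C F 2 ε₀ ε₂₉ B₃ a₀ a₁) p) 0 ≤ a₀ * (F.P p.K).eta 1 ^ 2)
    (hδ : epsOfRecord (theta13OfThm1C F 2 ε₀ ε₂₉ B₃ a₀ a₁).ν (gOfRecord₁₃ F 2 (theta13OfThm1C F 2 ε₀ ε₂₉ B₃ a₀ a₁) p) 1 * (F.P p.K).eta 1 ^ 2 +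
      4 * (2 * deltaOfRecord (theta13OfThm1C F 2 ε₀ ε₂₉ B₃ a₀ a₁).ν (gOfRecord₁₃ F 2 (theta13OfThm1C F 2 ε₀ ε₂₉ B₃ a₀ a₁) p) 0
        (theta13OfThm1C F 2 ε₀ ε₂₉ B₃ a₀ a₁).A₁) < 2) :
    ¬ (leavesP w p).densitiesDescribed := fun hD =>
  not_sLaw₁₃_one_su2_theta13OfThm1C_of_small_εreg ε₀ ε₂₉ B₃ a₀ a₁ p hK ha₀ ha3 ha2 h3 hε₁ hc hαε hδ
    ((densitiesDescribed_leavesP_iff_sLaw₁₃_all F 2 (theta13OfThm1C F 2 ε₀ ε₂₉ B₃ a₀ a₁) p w hC).1 hD 1 hK)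

end Thm1CWitness

/-! ## §3 (v1.1)  AT `θ₁₅ᶜ` WITH THE GRID CONDITION DISCHARGED (seat dag-n11-d's `three_mul_side_le_sideχ_theta13OfThm1C`, p508622) and their hypothesis list
verbatim: the §2 form of `ρ₁`, N11's node conclusion and — for a non-vacuous N11 conjunct — the run's interval hypothesis FAIL -/

section Thm1CWitnessClosed

open Summit.QuantumFields.YangMills.Theorems.BalabanUVNodesN11FirstStepFailsAtThm1CWitness (three_mul_side_le_sideχ_theta13OfThm1C)
open Literature.MathematicalPhysics.QuantumFieldTheory.Balaban1983to89.B16RLeafRecord13LiveRstep (rOperation_leavesP_theta13OfThm1C)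

variable {F : T4Family} (ε₀ ε₂₉ B₃ a₀ a₁ : ℝ) (p : B12.RunParams)

/-- **★★★ `¬ SLaw₁₃ F 2 θ₁₅ᶜ p 1` WITH n11-d's HYPOTHESIS LIST VERBATIM** (`0 < K`, `0 < a₀`, `C₀(4)a₀ ≤ ⅓`, `2a₀ ≤ 2δ₂∕(8L)²`, `0 < ε₁η₁²`, `ε₀(g₀) ≤ a₀η₀²`,
`ε₀(g₀) ≤ a₀η₁²`, `ε₁η₁² + 8δ₀ < 2`; the grid condition `3L ≤ sideχ` is their theorem `three_mul_side_le_sideχ_theta13OfThm1C`): the twin of their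
`not_tLaw₁₃_zero_theta13OfThm1C` for the §2 form of `ρ₁` itself. [cite: Balaban1988Convergent, Thm 1 p.262, (2.18) p.257, (3.25) p.270, (2.12) p.256, (3.16) p.268; Balaban1989LargeFieldI, (0.3)–(0.4) p.176; Balaban1985Averaging, Prop. 2 (52)–(54) p.26; Balaban1985Variational, Thm 1 p.279 (witness letters only)] -/
theorem not_sLaw₁₃_one_theta13OfThm1C (hK : 0 < p.K) (ha₀ : 0 < a₀)
    (ha3 : (143 * (((((F.P p.K).d + 4 : ℕ) : ℝ)) ^ 2 / 4) ^ 2) * a₀ ≤ 1 / 3)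
    (ha2 : 2 * a₀ ≤ 2 * deltaSU (Fin 2) / ((((F.P p.K).d + 4) * (F.P p.K).L : ℕ) : ℝ) ^ 2)
    (hε₁ : 0 < epsOfRecord (theta13OfThm1C F 2 ε₀ ε₂₉ B₃ a₀ a₁).ν (gOfRecord₁₃ F 2 (theta13OfThm1C F 2 ε₀ ε₂₉ B₃ a₀ a₁) p) 1 * (F.P p.K).eta 1 ^ 2)
    (hc : epsOfRecord (theta13OfThm1C F 2 ε₀ ε₂₉ B₃ a₀ a₁).ν (gOfRecord₁₃ F 2 (theta13OfThm1C F 2 ε₀ ε₂₉ B₃ a₀ a₁) p) 0 ≤ a₀ * (F.P p.K).eta 0 ^ 2)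
    (hαε : epsOfRecord (theta13OfThm1C F 2 ε₀ ε₂₉ B₃ a₀ a₁).ν (gOfRecord₁₃ F 2 (theta13OfThm1C F 2 ε₀ ε₂₉ B₃ a₀ a₁) p) 0 ≤ a₀ * (F.P p.K).eta 1 ^ 2)
    (hδ : epsOfRecord (theta13OfThm1C F 2 ε₀ ε₂₉ B₃ a₀ a₁).ν (gOfRecord₁₃ F 2 (theta13OfThm1C F 2 ε₀ ε₂₉ B₃ a₀ a₁) p) 1 * (F.P p.K).eta 1 ^ 2 +
      4 * (2 * deltaOfRecord (theta13OfThm1C F 2 ε₀ ε₂₉ B₃ a₀ a₁).ν (gOfRecord₁₃ F 2 (theta13OfThm1C F 2 ε₀ ε₂₉ B₃ a₀ a₁) p) 0 1) < 2) :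
    ¬ SLaw₁₃ F 2 (theta13OfThm1C F 2 ε₀ ε₂₉ B₃ a₀ a₁) p 1 :=
  not_sLaw₁₃_one_su2_theta13OfThm1C_of_small_εreg ε₀ ε₂₉ B₃ a₀ a₁ p hK ha₀ ha3 ha2
    (three_mul_side_le_sideχ_theta13OfThm1C F ε₀ ε₂₉ B₃ a₀ a₁ p) hε₁ hc hαε (by rw [Node00.theta13OfThm1C_A₁]; exact hδ)

/-- **★★★ N11's NODE CONCLUSION FAILS AT EVERY WORLD BOUND TO `θ₁₅ᶜ`'s C-BINDING**, same hypotheses (whatever datum re-key supplies `C`: v1.2 `datumOfRecord₁₃Sep`,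
v1.3 `datumOfRecord₁₃SepMixed`, … all carry `(coreOfRecord₁₃ θ₁₅ᶜ).construction (densOfRecord₁₃ θ₁₅ᶜ)`). [cite: Balaban1988Convergent, Thm 1 p.262, (2.18) p.257, (3.25) p.270, (2.12) p.256; Balaban1985Averaging, Prop. 2 (52)–(54) p.26; Balaban1985Variational, Thm 1 p.279 (witness letters only)] -/
theorem not_densitiesDescribed_leavesP_theta13OfThm1C (w : WorldP)
    (hC : w.C = (coreOfRecord₁₃ F 2 (theta13OfThm1C F 2 ε₀ ε₂₉ B₃ a₀ a₁)).construction (densOfRecord₁₃ F 2 (theta13OfThm1C F 2 ε₀ ε₂₉ B₃ a₀ a₁)))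
    (hK : 0 < p.K) (ha₀ : 0 < a₀)
    (ha3 : (143 * (((((F.P p.K).d + 4 : ℕ) : ℝ)) ^ 2 / 4) ^ 2) * a₀ ≤ 1 / 3)
    (ha2 : 2 * a₀ ≤ 2 * deltaSU (Fin 2) / ((((F.P p.K).d + 4) * (F.P p.K).L : ℕ) : ℝ) ^ 2)
    (hε₁ : 0 < epsOfRecord (theta13OfThm1C F 2 ε₀ ε₂₉ B₃ a₀ a₁).ν (gOfRecord₁₃ F 2 (theta13OfThm1C F 2 ε₀ ε₂₉ B₃ a₀ a₁) p) 1 * (F.P p.K).eta 1 ^ 2)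
    (hc : epsOfRecord (theta13OfThm1C F 2 ε₀ ε₂₉ B₃ a₀ a₁).ν (gOfRecord₁₃ F 2 (theta13OfThm1C F 2 ε₀ ε₂₉ B₃ a₀ a₁) p) 0 ≤ a₀ * (F.P p.K).eta 0 ^ 2)
    (hαε : epsOfRecord (theta13OfThm1C F 2 ε₀ ε₂₉ B₃ a₀ a₁).ν (gOfRecord₁₃ F 2 (theta13OfThm1C F 2 ε₀ ε₂₉ B₃ a₀ a₁) p) 0 ≤ a₀ * (F.P p.K).eta 1 ^ 2)
    (hδ : epsOfRecord (theta13OfThm1C F 2 ε₀ ε₂₉ B₃ a₀ a₁).ν (gOfRecord₁₃ F 2 (theta13OfThm1C F 2 ε₀ ε₂₉ B₃ a₀ a₁) p) 1 * (F.P p.K).eta 1 ^ 2 +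
      4 * (2 * deltaOfRecord (theta13OfThm1C F 2 ε₀ ε₂₉ B₃ a₀ a₁).ν (gOfRecord₁₃ F 2 (theta13OfThm1C F 2 ε₀ ε₂₉ B₃ a₀ a₁) p) 0 1) < 2) :
    ¬ (leavesP w p).densitiesDescribed := fun hD =>
  not_sLaw₁₃_one_theta13OfThm1C ε₀ ε₂₉ B₃ a₀ a₁ p hK ha₀ ha3 ha2 hε₁ hc hαε hδ
    ((densitiesDescribed_leavesP_iff_sLaw₁₃_all F 2 (theta13OfThm1C F 2 ε₀ ε₂₉ B₃ a₀ a₁) p w hC).1 hD 1 hK)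

/-- **★★ HENCE A NON-VACUOUS N11 CONJUNCT AT `θ₁₅ᶜ`'s WORLDS PUTS THE RUN OUTSIDE THE INTERVAL**: at a world with `C` = `θ₁₅ᶜ`'s construction of record and
`up = upOfRecord₅C … θ₁₅ᶜ` (K1's rung-1 binder shape over this witness), `Dag.B14_main (leavesP w p)` with the in-edge leaves, the small-field implication and
the flow control gives `¬ smallCouplings` on every run with `0 < K` meeting the letters (the 𝐑-antecedent is this seat's closed `rOperation_leavesP_theta13OfThm1C`
from the five admissibility signs). [cite: Balaban1988Convergent, Thm 1 p.262, Theorem p.245, p.244, (3.25) p.270, (2.12) p.256; Balaban1989LargeFieldI, (0.3)–(0.4) p.176; Balaban1985Averaging, Prop. 2 (52)–(54) p.26; Balaban1985Variational, Thm 1 p.279 (witness letters only)] -/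
theorem not_smallCouplings_of_b14_main_leavesP_theta13OfThm1C (w : WorldP)
    (hC : w.C = (coreOfRecord₁₃ F 2 (theta13OfThm1C F 2 ε₀ ε₂₉ B₃ a₀ a₁)).construction (densOfRecord₁₃ F 2 (theta13OfThm1C F 2 ε₀ ε₂₉ B₃ a₀ a₁)))
    (hup : w.up p = upOfRecord₅C F 2 ((theta13OfThm1C F 2 ε₀ ε₂₉ B₃ a₀ a₁).toStage5₁₃ F 2) p)
    (hε : 0 < ε₀) (hε' : 0 < ε₂₉) (hB : 0 ≤ B₃) (ha₀ : 0 < a₀) (ha₁ : 0 < a₁) (hK : 0 < p.K)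
    (ha3 : (143 * (((((F.P p.K).d + 4 : ℕ) : ℝ)) ^ 2 / 4) ^ 2) * a₀ ≤ 1 / 3)
    (ha2 : 2 * a₀ ≤ 2 * deltaSU (Fin 2) / ((((F.P p.K).d + 4) * (F.P p.K).L : ℕ) : ℝ) ^ 2)
    (hε₁ : 0 < epsOfRecord (theta13OfThm1C F 2 ε₀ ε₂₉ B₃ a₀ a₁).ν (gOfRecord₁₃ F 2 (theta13OfThm1C F 2 ε₀ ε₂₉ B₃ a₀ a₁) p) 1 * (F.P p.K).eta 1 ^ 2)
    (hc : epsOfRecord (theta13OfThm1C F 2 ε₀ ε₂₉ B₃ a₀ a₁).ν (gOfRecord₁₃ F 2 (theta13OfThm1C F 2 ε₀ ε₂₉ B₃ a₀ a₁) p) 0 ≤ a₀ * (F.P p.K).eta 0 ^ 2)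
    (hαε : epsOfRecord (theta13OfThm1C F 2 ε₀ ε₂₉ B₃ a₀ a₁).ν (gOfRecord₁₃ F 2 (theta13OfThm1C F 2 ε₀ ε₂₉ B₃ a₀ a₁) p) 0 ≤ a₀ * (F.P p.K).eta 1 ^ 2)
    (hδ : epsOfRecord (theta13OfThm1C F 2 ε₀ ε₂₉ B₃ a₀ a₁).ν (gOfRecord₁₃ F 2 (theta13OfThm1C F 2 ε₀ ε₂₉ B₃ a₀ a₁) p) 1 * (F.P p.K).eta 1 ^ 2 +
      4 * (2 * deltaOfRecord (theta13OfThm1C F 2 ε₀ ε₂₉ B₃ a₀ a₁).ν (gOfRecord₁₃ F 2 (theta13OfThm1C F 2 ε₀ ε₂₉ B₃ a₀ a₁) p) 0 1) < 2)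
    (h14 : Dag.B14_main (leavesP w p))
    (h7 : (leavesP w p).b7) (h8 : (leavesP w p).b8) (h9 : (leavesP w p).b9) (h10 : (leavesP w p).b10) (h11 : (leavesP w p).b11)
    (hsf : (leavesP w p).smallCouplings → (leavesP w p).smallFieldInductive) (hfc : (leavesP w p).smallCouplings → (leavesP w p).flowControl) :
    ¬ (leavesP w p).smallCouplings := fun hsc =>
  not_densitiesDescribed_leavesP_theta13OfThm1C ε₀ ε₂₉ B₃ a₀ a₁ p w hC hK ha₀ ha3 ha2 hε₁ hc hαε hδ
    (h14 h7 h8 h9 h10 h11 hsf hfc (rOperation_leavesP_theta13OfThm1C F 2 p w hup hε hε' hB ha₀ ha₁) hsc)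

end Thm1CWitnessClosed

end Summit.QuantumFields.YangMills.Theorems.BalabanUVNodesN11LiveRecordFirstLevelFails

end
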